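import Mathlib
import Literature.Combinatorics.Enumerative.EulerZigzagGeneratingFunction
import HarnessLib

/-!
# `(n+1) E_{2n+1}` is divisible by `2^{2n}` and the quotient — the Genocchi number `G_{2n+2}` — is odd (Han–Liu, Theorem 1)

Topic `Combinatorics/Enumerative`, namespace `Literature.Combinatorics.Enumerative`; a sequel of
`EulerZigzagGeneratingFunction.lean` (where `E_{2k−1} = T_k`, the tangent numbers of
`Literature.ComputerArithmetic.BrentZimmermann2010.TangentNumbers`).  THEOREMS ONLY (no definition, no named
fact, no `sorry`).

## Source, verbatim

G.-N. Han, J.-Y. Liu, *Combinatorial proofs of some properties of tangent and Genocchi numbers*, European J.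
Combin. 71 (2018) 99–110 = arXiv:1707.08882 [HanLiu2018Genocchi], §1:

> The tangent numbers `(T_{2n+1})_{n≥0}` appear in the Taylor expansion of `tan(x)`:
> `tan x = Σ_{n≥0} T_{2n+1} x^{2n+1}/(2n+1)!`. It is known that the tangent number `T_{2n+1}` is equal to the
> number of all alternating permutations of length `2n+1` […].
> **Theorem 1.** The number `(n+1)T_{2n+1}` is divisible by `2^{2n}`, and the quotient is an odd number.
> The quotient is called Genocchi number and denoted by `G_{2n+2} := (n+1)T_{2n+1}/2^{2n}`. […]
> `n` | 0 1 2 3 4 5 6;  `T_{2n+1}` | 1 2 16 272 7936 353792 22368256;  `G_{2n+2}` | 1 1 3 17 155 2073 38227.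
> The fact that the Genocchi numbers are odd integers is traditionally proved by using the von Staudt–Clausen
> theorem on Bernoulli numbers and the little Fermat theorem [Carlitz 1960, Carlitz 1971, Riordan–Stein 1973].

## What is formalized (road: the traditional proof named in the source — von Staudt–Clausen, which Mathlib has
as `Bernoulli.vonStaudt_clausen`, and Fermat's little theorem `ZMod.pow_card_sub_one_eq_one`)

* `mul_eulerZigzag_div_two_pow_eq_bernoulli`: `(n+1) E_{2n+1}/2^{2n} = (−1)ⁿ · 2(2^{2n+2} − 1) B_{2n+2}` in `ℚ`
  (from `T_k = (−1)^{k−1} 2^{2k}(2^{2k}−1) B_{2k}/(2k)`, the tree's `TangentNumbers.eqn_4_62`, at the junction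
  `E_{2k−1} = T_k` of the prequel).
* `odd_int_two_mul_bernoulli`: `2(2^{2k} − 1) B_{2k}` is an odd integer (`k ≥ 1`): by von Staudt–Clausen
  `B_{2k} = m − Σ_{p prime, (p−1) ∣ 2k} 1/p`; the prime `2` contributes the odd integer `2^{2k} − 1`, every odd
  prime `p` of the sum divides `2^{2k} − 1` (Fermat) and contributes an even integer.
* ★★★ `han_liu_theorem_one`: `2^{2n} ∣ (n+1) E_{2n+1}` and `(n+1) E_{2n+1}/2^{2n}` is odd; the values
  `G_2, …, G_{12} = 1, 1, 3, 17, 155, 2073` (`genocchi_values`).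

## References

* [HanLiu2018Genocchi] G.-N. Han, J.-Y. Liu, *Combinatorial proofs of some properties of tangent and Genocchi
  numbers*, European J. Combin. 71 (2018), 99–110 (arXiv:1707.08882), §1, Theorem 1 and equation (1.2).
* [BrentZimmermann2010] R. P. Brent, P. Zimmermann, *Modern Computer Arithmetic*, §4.7.2, (4.62).
* L. Carlitz, *The Staudt–Clausen theorem*, Math. Mag. 34 (1960/61), 131–146 (the traditional proof, as cited).
-/

namespace Literature.Combinatorics.Enumerative

open Finset
open scoped Nat
open Literature.ComputerArithmetic.BrentZimmermann2010

/-- `(n+1) E_{2n+1} / 2^{2n} = (−1)ⁿ · 2 (2^{2n+2} − 1) B_{2n+2}` (in `ℚ`), i.e. `G_{2k} = (−1)^{k−1} 2(2^{2k}−1)B_{2k}`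
with `k = n + 1`. [cite: HanLiu2018Genocchi, §1 (1.2) and «traditionally proved by using the von Staudt-Clausen theorem on Bernoulli numbers»] [cite: BrentZimmermann2010, §4.7.2 Eqn. (4.62)] -/
theorem mul_eulerZigzag_div_two_pow_eq_bernoulli (n : ℕ) :
    (((n + 1) * eulerZigzag (2 * n + 1) : ℕ) : ℚ) / 2 ^ (2 * n) =
      (-1) ^ n * 2 * (2 ^ (2 * n + 2) - 1) * bernoulli (2 * n + 2) := by
  have hT := TangentNumbers.eqn_4_62 (k := n + 1) (by omega)
  rw [← eulerZigzag_two_mul_sub_one_eq_T (by omega), show 2 * (n + 1) - 1 = 2 * n + 1 by omega,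
    Nat.add_sub_cancel, show 2 * (n + 1) = 2 * n + 2 by ring] at hT
  push_cast at hT ⊢
  have hn : (n : ℚ) + 1 ≠ 0 := by positivity
  have h2 : (2 : ℚ) ^ (2 * n + 2) = 2 ^ (2 * n) * 4 := by rw [pow_add]; norm_num
  rw [hT, h2]
  field_simp
  ring

/-- For an odd prime `p` with `(p − 1) ∣ 2k`: `p ∣ 2^{2k} − 1` (Fermat's little theorem).
[cite: HanLiu2018Genocchi, §1 («and the little Fermat theorem»)] -/
theorem prime_dvd_two_pow_sub_one {p k : ℕ} (hp : p.Prime) (hp2 : p ≠ 2) (hdvd : (p - 1) ∣ 2 * k) :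
    p ∣ 2 ^ (2 * k) - 1 := by
  haveI := Fact.mk hp
  obtain ⟨q, hq⟩ := hdvd
  have h2 : (2 : ZMod p) ≠ 0 := by
    intro h
    have h' : ((2 : ℕ) : ZMod p) = 0 := by exact_mod_cast h
    rw [ZMod.natCast_eq_zero_iff] at h'
    exact hp2 ((Nat.prime_dvd_prime_iff_eq hp Nat.prime_two).1 h')
  have hpow : (2 : ZMod p) ^ (2 * k) = 1 := by
    rw [hq, pow_mul, ZMod.pow_card_sub_one_eq_one h2, one_pow]
  rw [← ZMod.natCast_eq_zero_iff, Nat.cast_sub (Nat.one_le_two_pow), Nat.cast_pow, Nat.cast_two, hpow]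
  simp

/-- ★★ `2 (2^{2k} − 1) B_{2k}` is an odd integer for `k ≥ 1` (von Staudt–Clausen and Fermat: in
`B_{2k} = m − Σ_{(p−1)∣2k} 1/p` the prime `2` contributes the odd number `2^{2k} − 1`, each odd prime an even one).
[cite: HanLiu2018Genocchi, §1, Theorem 1 («the quotient is an odd number») and «traditionally proved by using the von Staudt-Clausen theorem … and the little Fermat theorem»] -/
theorem odd_int_two_mul_bernoulli {k : ℕ} (hk : 1 ≤ k) :
    ∃ z : ℤ, Odd z ∧ (2 * (2 ^ (2 * k) - 1) * bernoulli (2 * k) : ℚ) = z := by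
  obtain ⟨m, hm⟩ := Bernoulli.vonStaudt_clausen k
  set P := (range (2 * k + 2)).filter (fun p => p.Prime ∧ (p - 1) ∣ 2 * k) with hP
  -- every prime of the sum divides 2 (2^{2k} − 1); record the quotients
  have hdiv : ∀ p ∈ P, p ∣ 2 * (2 ^ (2 * k) - 1) := fun p hp => by
    rw [hP, mem_filter] at hp
    rcases eq_or_ne p 2 with rfl | hp2
    · exact dvd_mul_right 2 _
    · exact (prime_dvd_two_pow_sub_one hp.2.1 hp2 hp.2.2).mul_left 2
  -- the integer  z = 2(2^{2k}−1) m − Σ_p 2(2^{2k}−1)/p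
  refine ⟨2 * (2 ^ (2 * k) - 1) * m - ∑ p ∈ P, ((2 * (2 ^ (2 * k) - 1) / p : ℕ) : ℤ), ?_, ?_⟩
  · -- parity: the term p = 2 is odd, the others are even
    have h2P : 2 ∈ P := by
      rw [hP, mem_filter, mem_range]
      exact ⟨by omega, Nat.prime_two, by simp⟩
    have hsum : ∑ p ∈ P, ((2 * (2 ^ (2 * k) - 1) / p : ℕ) : ℤ) =
        ((2 ^ (2 * k) - 1 : ℕ) : ℤ) + ∑ p ∈ P.erase 2, ((2 * (2 ^ (2 * k) - 1) / p : ℕ) : ℤ) := by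
      rw [← add_sum_erase P _ h2P, Nat.mul_div_cancel_left _ (by norm_num : 0 < 2)]
    have heven : Even (∑ p ∈ P.erase 2, ((2 * (2 ^ (2 * k) - 1) / p : ℕ) : ℤ)) := by
      refine even_sum _ fun p hp => ?_
      have hp' := mem_of_mem_erase hp
      have hp2 : p ≠ 2 := ne_of_mem_erase hp
      rw [hP, mem_filter] at hp'
      obtain ⟨q, hq⟩ := prime_dvd_two_pow_sub_one hp'.2.1 hp2 hp'.2.2
      rw [hq, Nat.mul_left_comm, Nat.mul_div_cancel_left _ hp'.2.1.pos]
      exact ⟨q, by push_cast; ring⟩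
    have hodd1 : Odd (((2 ^ (2 * k) - 1 : ℕ) : ℤ)) := by
      rw [Nat.cast_sub Nat.one_le_two_pow]
      push_cast
      refine ⟨2 ^ (2 * k - 1) - 1, ?_⟩
      rw [show (2 : ℤ) ^ (2 * k) = 2 * 2 ^ (2 * k - 1) by rw [← pow_succ']; congr 1; omega]
      ring
    rw [hsum]
    obtain ⟨a, ha⟩ := heven
    obtain ⟨b, hb⟩ := hodd1
    rw [ha, hb]
    exact ⟨(2 ^ (2 * k) - 1) * m - b - a - 1, by ring⟩
  · -- the value
    have hB : bernoulli (2 * k) = (m : ℚ) - ∑ p ∈ P, (1 : ℚ) / p := by rw [hm]; ring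
    have hterm : ∀ p ∈ P, (((2 * (2 ^ (2 * k) - 1) / p : ℕ) : ℤ) : ℚ) =
        2 * (2 ^ (2 * k) - 1) * ((1 : ℚ) / p) := by
      intro p hp
      have hp0 : (p : ℚ) ≠ 0 := by
        rw [hP, mem_filter] at hp
        exact Nat.cast_ne_zero.2 hp.2.1.ne_zero
      rw [Int.cast_natCast, Nat.cast_div (hdiv p hp) hp0]
      push_cast [Nat.one_le_two_pow]
      ring
    rw [Int.cast_sub, Int.cast_sum, Finset.sum_congr rfl hterm, ← Finset.mul_sum, hB]
    push_cast
    ring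

/-- ★★★ **Theorem 1 of Han–Liu** (classically Carlitz / Riordan–Stein, via Genocchi numbers): `(n+1) T_{2n+1}` is
divisible by `2^{2n}` and the quotient `G_{2n+2} = (n+1)T_{2n+1}/2^{2n}` is odd — here with `T_{2n+1} = E_{2n+1}`,
the number of alternating permutations of length `2n+1`. [cite: HanLiu2018Genocchi, §1, Theorem 1] -/
theorem han_liu_theorem_one (n : ℕ) :
    2 ^ (2 * n) ∣ (n + 1) * eulerZigzag (2 * n + 1) ∧ Odd ((n + 1) * eulerZigzag (2 * n + 1) / 2 ^ (2 * n)) := by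
  obtain ⟨z, hzodd, hz⟩ := odd_int_two_mul_bernoulli (k := n + 1) (by omega)
  have hq := mul_eulerZigzag_div_two_pow_eq_bernoulli n
  rw [show 2 * (n + 1) = 2 * n + 2 by ring] at hz
  rw [mul_assoc ((-1 : ℚ) ^ n), mul_assoc ((-1 : ℚ) ^ n), hz, div_eq_iff (by positivity)] at hq
  -- (n+1) E_{2n+1} = ((-1)^n z) 2^{2n}  in ℤ, with (-1)^n z = |z|
  have hZ : (((n + 1) * eulerZigzag (2 * n + 1) : ℕ) : ℤ) = (-1) ^ n * z * 2 ^ (2 * n) := by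
    exact_mod_cast hq
  have habs : (-1 : ℤ) ^ n * z = (z.natAbs : ℤ) := by
    have h0 : (0 : ℤ) ≤ (-1) ^ n * z := by
      have h := hZ ▸ (Int.natCast_nonneg _)
      exact nonneg_of_mul_nonneg_left h (by positivity)
    rcases neg_one_pow_eq_or ℤ n with h | h <;> rw [h] at h0 ⊢
    · rw [one_mul] at h0 ⊢
      exact (Int.natAbs_of_nonneg h0).symm
    · rw [neg_one_mul] at h0 ⊢
      rw [← Int.natAbs_neg]
      exact (Int.natAbs_of_nonneg h0).symm
  have hN : (n + 1) * eulerZigzag (2 * n + 1) = 2 ^ (2 * n) * z.natAbs := by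
    have h := hZ
    rw [habs] at h
    exact_mod_cast (h.trans (mul_comm _ _))
  refine ⟨⟨z.natAbs, hN⟩, ?_⟩
  rw [hN, Nat.mul_div_cancel_left _ (by positivity)]
  exact Int.natAbs_odd.2 hzodd

/-- The Genocchi numbers `G₂, G₄, …, G₁₂ = 1, 1, 3, 17, 155, 2073` (`G_{2n+2} = (n+1)E_{2n+1}/2^{2n}`, `n ≤ 5`).
[cite: HanLiu2018Genocchi, §1 (table of T_{2n+1} and G_{2n+2})] -/
theorem genocchi_values :
    (List.range 6).map (fun n => (n + 1) * eulerZigzag (2 * n + 1) / 2 ^ (2 * n)) = [1, 1, 3, 17, 155, 2073] := by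
  have hE : ∀ n : ℕ, eulerZigzag (2 * n + 1) = TangentNumbers.T (n + 1) := fun n => by
    rw [← eulerZigzag_two_mul_sub_one_eq_T (by omega), show 2 * (n + 1) - 1 = 2 * n + 1 by omega]
  simp only [List.map, List.range, List.range.loop, hE]
  decide

/-- ★ **`2ⁿ ∣ E_{2n+1}`** — «`T_{2n+1}` is divisible by `2ⁿ`» (here a corollary of Theorem 1: `n + 1 < 2^{n+1}` has at
most `n` factors `2`). [cite: HanLiu2018Genocchi, §1 («This combinatorial interpretation immediately implies that T_{2n+1} is divisible by 2^n»)] -/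
theorem two_pow_dvd_eulerZigzag_two_mul_add_one (n : ℕ) : 2 ^ n ∣ eulerZigzag (2 * n + 1) := by
  obtain ⟨hdvd, -⟩ := han_liu_theorem_one n
  obtain ⟨a, b, hb, hab⟩ := Nat.exists_eq_two_pow_mul_odd (show n + 1 ≠ 0 by omega)
  -- `a ≤ n` since `2^a ≤ n + 1 < 2^(n+1)`
  have ha : a ≤ n := by
    have h1 : 2 ^ a ≤ n + 1 := by
      rw [hab]
      exact Nat.le_mul_of_pos_right _ hb.pos
    have h3 : 2 ^ a < 2 ^ (n + 1) := lt_of_le_of_lt h1 Nat.lt_two_pow_self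
    exact Nat.lt_succ_iff.1 ((Nat.pow_lt_pow_iff_right (by norm_num)).1 h3)
  rw [hab, mul_assoc, show 2 ^ (2 * n) = 2 ^ a * 2 ^ (2 * n - a) by rw [← pow_add]; congr 1; omega] at hdvd
  have h' : 2 ^ (2 * n - a) ∣ b * eulerZigzag (2 * n + 1) := Nat.dvd_of_mul_dvd_mul_left (by positivity) hdvd
  have hcop : Nat.Coprime (2 ^ (2 * n - a)) b := (hb.coprime_two_left).pow_left _
  exact (pow_dvd_pow 2 (show n ≤ 2 * n - a by omega)).trans (hcop.dvd_of_dvd_mul_left h')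

end Literature.Combinatorics.Enumerative
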